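import Literature.RepresentationTheory.CompactGroups.UnitaryGroupTwoTorusCharacter
import Literature.NumberTheory.Automorphic.CompactGroupCharacterProjectionIsotypic
import HarnessLib

/-!
# The character of an irreducible representation of `U(2)` on the diagonal torus, II:
# `χ(diag(z, w)) = (zw)^b (z^a + z^{a−1}w + ⋯ + w^a)`, `dim = a + 1`, the highest weight, and rigidity

Topic `RepresentationTheory/CompactGroups`; namespace `Literature.RepresentationTheory.CompactGroups.UnitaryTwo`.
Theorems only (no definition, no named fact, no instance, no `sorry`).  Sequel of `UnitaryGroupTwoTorusCharacter`
(the numerator form `(u₀ − u₁) χ(diag u) = u^A − u^{A∘swap}`): the `U(2)` case of WEYL'S CHARACTER FORMULA, uniqueness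
direction (Bröcker–tom Dieck II (4.12), VI (1.7); the irreducible characters of `U(2)` are the Schur polynomials
`(zw)^b (z^{a+1} − w^{a+1})/(z − w)` [BrockerTomDieck1985]; Knapp's parametrisation of `Û(2)` in the proof of Thm. 10.2
[Knapp1986]).  For an irreducible unitary norm-continuous `τ : ContRepresentation ℂ (Matrix.unitaryGroup (Fin 2) ℂ) E`,
`E` a finite-dimensional inner-product space:

* `exists_character_diagonalTorusHom_eq` — **(D1)–(D3)**: there are `a : ℕ`, `b : ℤ` with
  `χ_τ(diag u) = (u₀u₁)^b Σ_{j ≤ a} u₀^j u₁^{a−j}` on the torus, `dim E = a + 1`, and a non-zero HIGHEST-WEIGHT VECTOR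
  `x` with `τ(diag u) x = u₀^{a+b} u₁^b x`;
* `torusChar_injective` — the pair `(a, b)` is determined by the function `u ↦ (u₀u₁)^b Σ_{j≤a} u₀^j u₁^{a−j}`
  (**uniqueness in (D1)**);
* `areUnitarilyEquivalent_of_character_diagonalTorusHom_eq` — **(D4′)**: two irreducible unitary representations of
  `U(2)` whose characters agree on the diagonal torus are unitarily equivalent (every element is conjugate into the
  torus, ★ `exists_conj_mem_diagonalTorus`; Schur's `dim Hom = ∫ conj χ χ'` ★ `Schur.nonempty_intertwiners_ne_zero_iff`;
  Mathlib's Schur lemma `Representation.IsIrreducible.bijective_or_eq_zero`; ★ `areUnitarilyEquivalent_toContRep_of_equiv`).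

Tools: the density argument `(u₀ − u₁) h(u) = 0, h continuous ⇒ h = 0` (`eq_zero_of_sub_mul_eq_zero`) and the
telescoping identity `(z − w)(zw)^b Σ_{j≤a} z^j w^{a−j} = z^{a+b+1} w^b − z^b w^{a+b+1}` (Mathlib `geom_sum₂_mul`).
Written for the `hodgecm-mathlib` cell (road HC, node H4b); generic.

## References
* T. Bröcker, T. tom Dieck, *Representations of Compact Lie Groups*, GTM 98 (1985), II (4.12), IV (3.1), VI (1.7)
  [BrockerTomDieck1985].
* A. W. Knapp, *Representation Theory of Semisimple Groups* (1986), proof of Thm. 10.2 [Knapp1986].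
* A. Deitmar, S. Echterhoff, *Principles of Harmonic Analysis*, 2nd ed. (2014), Cor. 6.1.9 [DeitmarEchterhoff2014].
-/

set_option autoImplicit false

noncomputable section

open MeasureTheory Complex Module Finset
open Literature.LinearAlgebra.Matrix (diagonalTorus diagonalTorusHom coe_diagonalTorusHom_apply continuous_diagonalTorusHom
  range_diagonalTorusHom exists_conj_mem_diagonalTorus)
open Literature.MathematicalPhysics.QuantumFieldTheory (haarProbability)
open scoped InnerProductSpace ComplexConjugate Real

namespace Literature.RepresentationTheory.CompactGroups

namespace UnitaryTwo

/-! ### §1 Two elementary tools on the torus `U(1)²` -/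

/-- The coordinates of the torus are continuous complex-valued functions. [folklore] -/
private theorem continuous_coord (i : Fin 2) : Continuous fun u : Fin 2 → Circle => (u i : ℂ) :=
  continuous_subtype_val.comp (continuous_apply i)

/-- The candidate character `u ↦ (u₀u₁)^b Σ_{j≤a} u₀^j u₁^{a−j}` is continuous on the torus. [cite: BrockerTomDieck1985, VI (1.7)] -/
theorem continuous_torusChar (a : ℕ) (b : ℤ) :
    Continuous fun u : Fin 2 → Circle =>
      ((u 0 : ℂ) * u 1) ^ b * ∑ j ∈ range (a + 1), (u 0 : ℂ) ^ j * (u 1 : ℂ) ^ (a - j) := by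
  refine (((continuous_coord 0).mul (continuous_coord 1)).zpow₀ b fun u => Or.inl ?_).mul
    (continuous_finsetSum _ fun j _ => ((continuous_coord 0).pow j).mul ((continuous_coord 1).pow (a - j)))
  exact mul_ne_zero (Circle.coe_ne_zero (u 0)) (Circle.coe_ne_zero (u 1))

/-- **Division by `u₀ − u₁` on the torus**: a continuous `h : U(1)² → ℂ` with `(u₀ − u₁) h(u) = 0` everywhere vanishes
identically (the off-diagonal set `{u₀ ≠ u₁}` accumulates at every diagonal point along `t ↦ (u₀e^{it}, u₁)`).
[cite: BrockerTomDieck1985, VI (1.7)] -/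
theorem eq_zero_of_sub_mul_eq_zero {h : (Fin 2 → Circle) → ℂ} (hc : Continuous h)
    (H : ∀ u : Fin 2 → Circle, ((u 0 : ℂ) - u 1) * h u = 0) (u : Fin 2 → Circle) : h u = 0 := by
  by_cases hne : (u 0 : ℂ) ≠ u 1
  · exact (mul_eq_zero.mp (H u)).resolve_left (sub_ne_zero.mpr hne)
  push Not at hne
  -- the path `γ t = (u₀ e^{it}, u₁)`
  let γ : ℝ → (Fin 2 → Circle) := fun t => Function.update u 0 (u 0 * Circle.exp t)
  have hγc : Continuous γ := continuous_const.update 0 (continuous_const.mul Circle.exp.continuous)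
  have hγ0 : γ 0 = u := by
    simp only [γ, Circle.exp_zero, mul_one, Function.update_eq_self]
  have hZ : IsClosed {t : ℝ | h (γ t) = 0} := isClosed_eq (hc.comp hγc) continuous_const
  have hI : Set.Ioo 0 (2 * π) ⊆ {t : ℝ | h (γ t) = 0} := by
    intro t ht
    have h0 : (γ t 0 : ℂ) = (u 0 : ℂ) * cexp (t * I) := by
      simp only [γ, Function.update_self, Circle.coe_mul, Circle.coe_exp]
    have h1 : (γ t 1 : ℂ) = u 0 := by
      rw [show γ t 1 = u 1 from Function.update_of_ne (by decide) _ _, ← hne]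
    have hexp : cexp (t * I) ≠ 1 := by
      intro h1'
      obtain ⟨n, hn⟩ := Complex.exp_eq_one_iff.mp h1'
      have hre := congrArg Complex.im hn
      simp only [Complex.mul_im, Complex.ofReal_re, Complex.I_im, Complex.ofReal_im, Complex.I_re, mul_zero, mul_one,
        add_zero, Complex.mul_re, Complex.intCast_re, Complex.intCast_im, Complex.re_ofNat, Complex.im_ofNat,
        zero_mul, sub_zero] at hre
      -- `t = n · 2π` with `0 < t < 2π`
      have hlt : (0 : ℝ) < n ∧ (n : ℝ) < 1 := by
        constructor <;> nlinarith [ht.1, ht.2, Real.pi_pos]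
      have h01 : (0 : ℤ) < n ∧ n < 1 := ⟨by exact_mod_cast hlt.1, by exact_mod_cast hlt.2⟩
      omega
    have hdiff : (γ t 0 : ℂ) - γ t 1 ≠ 0 := by
      rw [h0, h1, ← mul_sub_one]
      exact mul_ne_zero (Circle.coe_ne_zero (u 0)) (sub_ne_zero.mpr hexp)
    exact (mul_eq_zero.mp (H (γ t))).resolve_left hdiff
  have h0mem : (0 : ℝ) ∈ closure (Set.Ioo 0 (2 * π)) := by
    rw [closure_Ioo (by positivity : (0 : ℝ) ≠ 2 * π)]
    exact ⟨le_refl _, by positivity⟩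
  have h := (hZ.closure_subset_iff.mpr hI) h0mem
  simpa only [Set.mem_setOf_eq, hγ0] using h

/-- **The telescoping identity** `(u₀ − u₁) · (u₀u₁)^b Σ_{j≤a} u₀^j u₁^{a−j} = u₀^{a+1+b} u₁^b − u₀^b u₁^{a+1+b}`
(Weyl numerator over the Weyl denominator of `U(2)`). [cite: BrockerTomDieck1985, VI (1.7)] -/
theorem sub_mul_torusChar (a : ℕ) (b : ℤ) (u : Fin 2 → Circle) :
    ((u 0 : ℂ) - u 1) * (((u 0 : ℂ) * u 1) ^ b * ∑ j ∈ range (a + 1), (u 0 : ℂ) ^ j * (u 1 : ℂ) ^ (a - j)) =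
      (u 0 : ℂ) ^ ((a : ℤ) + 1 + b) * (u 1 : ℂ) ^ b - (u 0 : ℂ) ^ b * (u 1 : ℂ) ^ ((a : ℤ) + 1 + b) := by
  have h := geom_sum₂_mul (u 0 : ℂ) (u 1) (a + 1)
  simp only [Nat.add_sub_cancel] at h
  have h0 : (u 0 : ℂ) ≠ 0 := Circle.coe_ne_zero _
  have h1 : (u 1 : ℂ) ≠ 0 := Circle.coe_ne_zero _
  rw [zpow_add₀ h0, zpow_add₀ h1, show ((a : ℤ) + 1) = ((a + 1 : ℕ) : ℤ) by push_cast; ring, zpow_natCast,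
    zpow_natCast, mul_zpow]
  linear_combination ((u 0 : ℂ) ^ b * (u 1 : ℂ) ^ b) * h

/-- The candidate character at `u = 1` is `a + 1`. [cite: BrockerTomDieck1985, VI (1.7)] -/
theorem torusChar_one (a : ℕ) (b : ℤ) :
    (((1 : Fin 2 → Circle) 0 : ℂ) * (1 : Fin 2 → Circle) 1) ^ b *
        ∑ j ∈ range (a + 1), ((1 : Fin 2 → Circle) 0 : ℂ) ^ j * ((1 : Fin 2 → Circle) 1 : ℂ) ^ (a - j) = (a : ℂ) + 1 := by
  simp only [Pi.one_apply, Circle.coe_one, mul_one, one_zpow, one_pow, one_mul, sum_const, card_range, nsmul_eq_mul,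
    Nat.cast_add, Nat.cast_one]

/-- **Uniqueness in (D1)**: the function `u ↦ (u₀u₁)^b Σ_{j≤a} u₀^j u₁^{a−j}` on the torus determines `(a, b)` (value
`a + 1` at `u = 1`; on the diagonal `u = (z, z)` it is `(a+1) z^{2b+a}`). [cite: BrockerTomDieck1985, VI (1.7)] -/
theorem torusChar_injective {a a' : ℕ} {b b' : ℤ}
    (h : ∀ u : Fin 2 → Circle,
      ((u 0 : ℂ) * u 1) ^ b * ∑ j ∈ range (a + 1), (u 0 : ℂ) ^ j * (u 1 : ℂ) ^ (a - j) =
        ((u 0 : ℂ) * u 1) ^ b' * ∑ j ∈ range (a' + 1), (u 0 : ℂ) ^ j * (u 1 : ℂ) ^ (a' - j)) :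
    a = a' ∧ b = b' := by
  have h1 := h 1
  rw [torusChar_one, torusChar_one] at h1
  have ha : a = a' := by exact_mod_cast (add_right_cancel h1 : (a : ℂ) = a')
  subst ha
  refine ⟨rfl, ?_⟩
  -- on the diagonal `u = (z, z)`: `Σ_j z^j z^{a−j} = (a+1) z^a ≠ 0`, so `(z²)^b = (z²)^{b'}`
  have hdiag : ∀ z : Circle, ∑ j ∈ range (a + 1), (z : ℂ) ^ j * (z : ℂ) ^ (a - j) = ((a : ℂ) + 1) * (z : ℂ) ^ a := by
    intro z
    rw [Finset.sum_congr rfl fun j hj => by rw [← pow_add, Nat.add_sub_cancel' (Nat.lt_succ_iff.mp (mem_range.mp hj))],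
      sum_const, card_range, nsmul_eq_mul]
    push_cast
    ring
  have hz : ∀ z : Circle, ((z : ℂ) * z) ^ b = ((z : ℂ) * z) ^ b' := by
    intro z
    have hz' := h fun _ => z
    simp only [hdiag] at hz'
    have hne : ((a : ℂ) + 1) * (z : ℂ) ^ a ≠ 0 :=
      mul_ne_zero (by exact_mod_cast Nat.succ_ne_zero a) (pow_ne_zero _ (Circle.coe_ne_zero z))
    exact mul_right_cancel₀ hne hz'
  have h2 : 2 * b = 2 * b' := by
    refine CircleChar.zpow_injective' fun z => Circle.ext ?_
    rw [Circle.coe_zpow, Circle.coe_zpow, zpow_mul, zpow_mul, zpow_two]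
    exact hz z
  omega

/-! ### §2 The character on the torus, the dimension and the highest weight -/

variable {E : Type*} [NormedAddCommGroup E] [InnerProductSpace ℂ E] [FiniteDimensional ℂ E]
variable (τ : ContRepresentation ℂ (Matrix.unitaryGroup (Fin 2) ℂ) E)

/-- **WEYL'S CHARACTER FORMULA FOR `U(2)`, UNIQUENESS DIRECTION — (D1) (D2) (D3)**: for an irreducible unitary
norm-continuous representation `τ` of `U(2)` on a finite-dimensional inner-product space `E` there are `a : ℕ`, `b : ℤ`
such that (D1) `χ_τ(diag(u₀, u₁)) = (u₀u₁)^b Σ_{j ≤ a} u₀^j u₁^{a−j}` for all `u` in the diagonal torus, (D2)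
`dim E = a + 1`, and (D3) the HIGHEST WEIGHT `(a + b, b)` occurs: some `x ≠ 0` satisfies `τ(diag u) x = u₀^{a+b} u₁^b x`.
[cite: BrockerTomDieck1985, VI (1.7)] [cite: Knapp1986, Thm. 10.2 (proof)] -/
theorem exists_character_diagonalTorusHom_eq (hτ : Continuous (τ : Matrix.unitaryGroup (Fin 2) ℂ → E →L[ℂ] E))
    [τ.toRepresentation.IsIrreducible] (hu : ∀ (g : Matrix.unitaryGroup (Fin 2) ℂ) (v w : E), ⟪τ g v, τ g w⟫_ℂ = ⟪v, w⟫_ℂ) :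
    ∃ (a : ℕ) (b : ℤ),
      (∀ u : Fin 2 → Circle, Schur.character τ (diagonalTorusHom (Fin 2) u) =
        ((u 0 : ℂ) * u 1) ^ b * ∑ j ∈ range (a + 1), (u 0 : ℂ) ^ j * (u 1 : ℂ) ^ (a - j)) ∧
      finrank ℂ E = a + 1 ∧
      ∃ x : E, x ≠ 0 ∧ ∀ u : Fin 2 → Circle,
        τ (diagonalTorusHom (Fin 2) u) x = ((u 0 : ℂ) ^ ((a : ℤ) + b) * (u 1 : ℂ) ^ b) • x := by
  obtain ⟨A, hA01, hnum, x, hx0, hx⟩ := exists_sub_mul_character_eq τ hτ hu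
  have hcont : Continuous fun u : Fin 2 → Circle => Schur.character τ (diagonalTorusHom (Fin 2) u) :=
    (continuous_character τ hτ).comp (continuous_diagonalTorusHom (Fin 2))
  have hprodA : ∀ u : Fin 2 → Circle, (∏ i, (u i : ℂ) ^ A i) = (u 0 : ℂ) ^ A 0 * (u 1 : ℂ) ^ A 1 := fun u =>
    Fin.prod_univ_two _
  have hprodσ : ∀ u : Fin 2 → Circle, (∏ i, (u i : ℂ) ^ (A ∘ Equiv.swap 0 1) i) = (u 0 : ℂ) ^ A 1 * (u 1 : ℂ) ^ A 0 :=
    fun u => by simp [Fin.prod_univ_two]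
  have hchar1 : Schur.character τ (diagonalTorusHom (Fin 2) 1) = (finrank ℂ E : ℂ) := by
    rw [map_one, Schur.character_one]
  rcases lt_or_gt_of_ne hA01 with hlt | hgt
  · -- `A 0 < A 1` contradicts `χ(1) = dim E ≥ 0`
    exfalso
    obtain ⟨a, ha⟩ : ∃ a : ℕ, (a : ℤ) = A 1 - A 0 - 1 := ⟨(A 1 - A 0 - 1).toNat, Int.toNat_of_nonneg (by omega)⟩
    have key : ∀ u : Fin 2 → Circle, ((u 0 : ℂ) - u 1) *
        (Schur.character τ (diagonalTorusHom (Fin 2) u) +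
          ((u 0 : ℂ) * u 1) ^ A 0 * ∑ j ∈ range (a + 1), (u 0 : ℂ) ^ j * (u 1 : ℂ) ^ (a - j)) = 0 := by
      intro u
      rw [mul_add, hnum u, sub_mul_torusChar a (A 0) u, hprodA, hprodσ, show (a : ℤ) + 1 + A 0 = A 1 by omega]
      ring
    have h0 := eq_zero_of_sub_mul_eq_zero (h := fun u => Schur.character τ (diagonalTorusHom (Fin 2) u) +
      ((u 0 : ℂ) * u 1) ^ A 0 * ∑ j ∈ range (a + 1), (u 0 : ℂ) ^ j * (u 1 : ℂ) ^ (a - j))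
      (hcont.add (continuous_torusChar a (A 0))) key 1
    rw [hchar1, torusChar_one] at h0
    have : (finrank ℂ E : ℝ) + (a + 1) = 0 := by exact_mod_cast congrArg Complex.re h0
    linarith [Nat.cast_nonneg (α := ℝ) (finrank ℂ E), Nat.cast_nonneg (α := ℝ) a]
  · -- `A 1 < A 0`: `a = A 0 − A 1 − 1`, `b = A 1`
    obtain ⟨a, ha⟩ : ∃ a : ℕ, (a : ℤ) = A 0 - A 1 - 1 := ⟨(A 0 - A 1 - 1).toNat, Int.toNat_of_nonneg (by omega)⟩
    have key : ∀ u : Fin 2 → Circle, ((u 0 : ℂ) - u 1) *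
        (Schur.character τ (diagonalTorusHom (Fin 2) u) -
          ((u 0 : ℂ) * u 1) ^ A 1 * ∑ j ∈ range (a + 1), (u 0 : ℂ) ^ j * (u 1 : ℂ) ^ (a - j)) = 0 := by
      intro u
      rw [mul_sub, hnum u, sub_mul_torusChar a (A 1) u, hprodA, hprodσ, show (a : ℤ) + 1 + A 1 = A 0 by omega]
      ring
    have hzero : ∀ u : Fin 2 → Circle, Schur.character τ (diagonalTorusHom (Fin 2) u) -
        ((u 0 : ℂ) * u 1) ^ A 1 * ∑ j ∈ range (a + 1), (u 0 : ℂ) ^ j * (u 1 : ℂ) ^ (a - j) = 0 := fun u => by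
      have h := eq_zero_of_sub_mul_eq_zero (h := fun u => Schur.character τ (diagonalTorusHom (Fin 2) u) -
        ((u 0 : ℂ) * u 1) ^ A 1 * ∑ j ∈ range (a + 1), (u 0 : ℂ) ^ j * (u 1 : ℂ) ^ (a - j))
        (hcont.sub (continuous_torusChar a (A 1))) key u
      exact h
    refine ⟨a, A 1, fun u => sub_eq_zero.mp (hzero u), ?_, x, hx0, fun u => ?_⟩
    · have h1 := sub_eq_zero.mp (hzero 1)
      rw [hchar1, torusChar_one] at h1
      exact_mod_cast h1
    · rw [hx u, show A 0 - 1 = (a : ℤ) + A 1 by omega]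

/-! ### §3 Rigidity: the character determines an irreducible representation up to unitary equivalence -/

end UnitaryTwo

namespace Schur

/-- **SAME CHARACTER ⇒ UNITARILY EQUIVALENT** (any compact group): two irreducible unitary norm-continuous
finite-dimensional representations `τ`, `τ'` of a compact group with `χ_τ = χ_τ'` are unitarily equivalent —
`∫ conj χ_τ χ_τ' dμ = ∫ |χ_τ|² dμ = 1 ≠ 0` gives a non-zero intertwiner (Bröcker–tom Dieck II (4.11)–(4.12)), which is
bijective by Schur's lemma, and an equivalence of irreducible unitary representations is a multiple of a unitary one
(Deitmar–Echterhoff Cor. 6.1.9; the argument of ★ `Schur.areUnitarilyEquivalent_of_equiv`, here through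
★ `areUnitarilyEquivalent_toContRep_of_equiv` and the tautological isometric equivalence `τ' ≃ τ'|_⊤`).
[cite: BrockerTomDieck1985, II (4.12)] [cite: DeitmarEchterhoff2014, Cor. 6.1.9] -/
theorem areUnitarilyEquivalent_of_character_eq {G : Type*} [Group G] [TopologicalSpace G] [IsTopologicalGroup G]
    [MeasurableSpace G] [BorelSpace G] [CompactSpace G] (μ : Measure G) [IsProbabilityMeasure μ] [μ.IsMulLeftInvariant]
    {E E' : Type*} [NormedAddCommGroup E] [InnerProductSpace ℂ E] [FiniteDimensional ℂ E]
    [NormedAddCommGroup E'] [InnerProductSpace ℂ E'] [FiniteDimensional ℂ E']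
    (τ : ContRepresentation ℂ G E) (τ' : ContRepresentation ℂ G E')
    (hτ : Continuous (τ : G → E →L[ℂ] E)) (hτ' : Continuous (τ' : G → E' →L[ℂ] E'))
    [τ.toRepresentation.IsIrreducible] [τ'.toRepresentation.IsIrreducible]
    (hu : ∀ (g : G) (v w : E), ⟪τ g v, τ g w⟫_ℂ = ⟪v, w⟫_ℂ) (hu' : ∀ (g : G) (v w : E'), ⟪τ' g v, τ' g w⟫_ℂ = ⟪v, w⟫_ℂ)
    (h : ∀ g : G, Schur.character τ g = Schur.character τ' g) : ContRepresentation.AreUnitarilyEquivalent τ τ' := by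
  -- Schur (4.11): a non-zero intertwiner `τ → τ'`
  have hint : ∫ g, conj (Schur.character τ g) * Schur.character τ' g ∂μ ≠ 0 := by
    simp_rw [← h]
    rw [Schur.integral_conj_character_mul_character μ hτ hu]
    exact one_ne_zero
  obtain ⟨f, hf, hf0⟩ := (Schur.nonempty_intertwiners_ne_zero_iff μ hτ hτ' hu).mpr hint
  set T := Schur.intertwinersEquiv τ τ' ⟨f, hf⟩ with hT
  have hT0 : T ≠ 0 := by
    intro h0
    have h1 : (⟨f, hf⟩ : Schur.intertwiners τ τ') = 0 := (Schur.intertwinersEquiv τ τ').map_eq_zero_iff.mp h0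
    exact hf0 (congrArg Subtype.val h1)
  -- Schur's lemma: it is bijective, i.e. an equivalence of representations
  have hb : Function.Bijective T := (Representation.IsIrreducible.bijective_or_eq_zero T).resolve_right hT0
  let e : τ.toRepresentation.Equiv τ'.toRepresentation := T.ofBijective hb
  -- an equivalence of irreducible unitary representations is a multiple of a unitary one (Deitmar–Echterhoff 6.1.9):
  -- through the tautological isometric equivalence `τ' ≃ τ'|_⊤` and ★ `areUnitarilyEquivalent_toContRep_of_equiv`
  haveI : CompleteSpace E' := FiniteDimensional.complete ℂ E'
  have hτ'U : τ'.IsUnitary := ContRepresentation.isUnitary_iff_inner_map_map.mpr hu'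
  let W : ContRepresentation.ClosedSubrep τ' := ⊤
  let i : E' ≃L[ℂ] W.toSubmodule :=
    { toFun := fun x => ⟨x, Submodule.mem_top⟩
      invFun := fun y => (y : E')
      map_add' := fun _ _ => rfl
      map_smul' := fun _ _ => rfl
      left_inv := fun _ => rfl
      right_inv := fun _ => rfl
      continuous_toFun := continuous_id.subtype_mk _
      continuous_invFun := continuous_subtype_val }
  let eW : τ'.Equiv W.toContRep := ContRepresentation.Equiv.mk i fun g => by
    refine ContinuousLinearMap.ext fun x => Subtype.ext ?_
    rfl
  have hW : ContRepresentation.AreUnitarilyEquivalent τ' W.toContRep := ⟨eW, Isometry.of_dist_eq fun _ _ => rfl⟩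
  let e' : τ.toRepresentation.Equiv W.toContRep.toRepresentation :=
    e.trans (Representation.Equiv.mk i.toLinearEquiv fun g => by
      refine LinearMap.ext fun x => Subtype.ext ?_
      rfl)
  have h' : ContRepresentation.AreUnitarilyEquivalent W.toContRep τ :=
    Literature.NumberTheory.Automorphic.areUnitarilyEquivalent_toContRep_of_equiv hτ'U W hu e'
  exact (hW.trans h').symm

end Schur

namespace UnitaryTwo

variable {E : Type*} [NormedAddCommGroup E] [InnerProductSpace ℂ E] [FiniteDimensional ℂ E]
variable (τ : ContRepresentation ℂ (Matrix.unitaryGroup (Fin 2) ℂ) E)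

omit [FiniteDimensional ℂ E] in
/-- A character of `U(2)` is determined by its restriction to the diagonal torus (every unitary matrix is conjugate
into the torus and characters are class functions). [cite: BrockerTomDieck1985, IV (3.1)] -/
theorem character_eq_of_character_diagonalTorusHom_eq {E' : Type*} [NormedAddCommGroup E'] [InnerProductSpace ℂ E']
    (τ' : ContRepresentation ℂ (Matrix.unitaryGroup (Fin 2) ℂ) E')
    (h : ∀ u : Fin 2 → Circle,
      Schur.character τ (diagonalTorusHom (Fin 2) u) = Schur.character τ' (diagonalTorusHom (Fin 2) u))
    (g : Matrix.unitaryGroup (Fin 2) ℂ) : Schur.character τ g = Schur.character τ' g := by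
  obtain ⟨V, hV⟩ := exists_conj_mem_diagonalTorus g
  rw [← range_diagonalTorusHom] at hV
  obtain ⟨z, hz⟩ := hV
  have hg : g = V * diagonalTorusHom (Fin 2) z * V⁻¹ := by rw [hz]; group
  rw [hg, Schur.character_conj, Schur.character_conj, h]

omit [FiniteDimensional ℂ E] in
/-- The normalised Haar measure of `U(2)` is a probability measure (instance helper). [folklore] -/
private theorem isProbabilityMeasure_haarProbability :
    IsProbabilityMeasure (haarProbability (Matrix.unitaryGroup (Fin 2) ℂ)) :=
  ⟨by simpa [haarProbability] using Measure.haarMeasure_self (G := Matrix.unitaryGroup (Fin 2) ℂ) (K₀ := ⊤)⟩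

/-- **(D4′) SAME TORUS CHARACTER ⇒ UNITARILY EQUIVALENT**: two irreducible unitary norm-continuous representations of
`U(2)` whose characters agree on the diagonal torus are unitarily equivalent.
[cite: BrockerTomDieck1985, II (4.12)] [cite: DeitmarEchterhoff2014, Cor. 6.1.9] -/
theorem areUnitarilyEquivalent_of_character_diagonalTorusHom_eq {E' : Type*} [NormedAddCommGroup E']
    [InnerProductSpace ℂ E'] [FiniteDimensional ℂ E'] (τ' : ContRepresentation ℂ (Matrix.unitaryGroup (Fin 2) ℂ) E')
    (hτ : Continuous (τ : Matrix.unitaryGroup (Fin 2) ℂ → E →L[ℂ] E))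
    (hτ' : Continuous (τ' : Matrix.unitaryGroup (Fin 2) ℂ → E' →L[ℂ] E'))
    [τ.toRepresentation.IsIrreducible] [τ'.toRepresentation.IsIrreducible]
    (hu : ∀ (g : Matrix.unitaryGroup (Fin 2) ℂ) (v w : E), ⟪τ g v, τ g w⟫_ℂ = ⟪v, w⟫_ℂ)
    (hu' : ∀ (g : Matrix.unitaryGroup (Fin 2) ℂ) (v w : E'), ⟪τ' g v, τ' g w⟫_ℂ = ⟪v, w⟫_ℂ)
    (h : ∀ u : Fin 2 → Circle,
      Schur.character τ (diagonalTorusHom (Fin 2) u) = Schur.character τ' (diagonalTorusHom (Fin 2) u)) :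
    ContRepresentation.AreUnitarilyEquivalent τ τ' := by
  haveI := isProbabilityMeasure_haarProbability
  exact Schur.areUnitarilyEquivalent_of_character_eq (haarProbability (Matrix.unitaryGroup (Fin 2) ℂ)) τ τ' hτ hτ' hu hu'
    (character_eq_of_character_diagonalTorusHom_eq τ τ' h)

end UnitaryTwo

end Literature.RepresentationTheory.CompactGroups

end
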